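import Summits.Ventures.PercRepro.RLSRuleProfile
import Summits.Ventures.PercRepro.RLSRuleLinePointT1

/-!
# C-025 at q = 3: `R₃⁺` on an ARBITRARY plane of the core — the accounting (night-3, gen 4)

The supply of a plane `G` of the core from the witnesses `B′ ∪ X` (`B′` a rank-`3` subset, `X` in the witness family
of an independent `K ⊆ E ∖ G`), charged conservatively: a `𝒯₀` subset (`≤ 5` points) at its crude share
`ρ₃(B′)/C(b + x, 3)`, a larger subset at the winner share `1`, and every subset only on the witnesses that are GOOD for
the lines of a chosen set `Λ` inside it (for the lines outside `Λ` no coplanar triple exists).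

* `sum_filter_subset_witnessFamily'` — the witnesses through a fixed triple, for any `|K| = N + 3`;
* `sum_good_ge_sub` — the UNION BOUND: the good witnesses of a set with `j` charged lines pay at least the full
  sum minus `j` times the sum over the witnesses through one fixed triple;
* **`supply_ge_profile`** — the assembly: for every family `𝔅` of rank-`3` subsets of `G`,
  `Σ_{B′ ∈ 𝔅} Σ_X [X good for Λ ∩ B′] · share(B′, X) ≤ Σ_{S ∈ Yq} w⁺(G, S)`;
* `eRk_sdiff_ge_of_mem_UqG` — a bottom set has `ρ(G ∖ B′) ≥ t` when `ρ(E ∖ G) + t ≤ p` (the demand at `t = 3`).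
Every plane instance is then an arithmetic inequality in its subset profile.  Imports `RLSRuleProfile`, `RLSRuleLinePointT1`.  Axioms: standard.
-/

open scoped Matroid

namespace PercRepro

namespace NightThree

open Finset ThmH PerFlat

variable {α : Type*} [DecidableEq α] {M : Matroid α} [M.Finite]

omit [M.Finite] in
/-- The supersets of a fixed `3`-subset `C` of `K` (`|K| = N + 3`) in the witness family, weighted by a function of
the size: `Σ_{j < n − 2} C(N, j) · g(j + 3)`. -/
theorem sum_filter_subset_witnessFamily' {K C : Finset α} {n N : ℕ} (hn : 2 ≤ n) (hK : K.card = N + 3)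
    (hC : C ⊆ K) (hCc : C.card = 3) (g : ℕ → ℚ) :
    ∑ X ∈ (witnessFamily K n).filter (fun X => C ⊆ X), g X.card =
      ∑ j ∈ range (n - 2), (N.choose j : ℚ) * g (j + 3) := by
  classical
  unfold witnessFamily
  rw [Finset.filter_biUnion, Finset.sum_biUnion]
  · have hinner : ∀ x ∈ Finset.Ico 1 (n + 1),
        ∑ X ∈ (K.powersetCard x).filter (fun X => C ⊆ X), g X.card =
          if 3 ≤ x then (N.choose (x - 3) : ℚ) * g x else 0 := by
      intro x _
      rw [Finset.sum_congr rfl (fun X hX => by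
        rw [(Finset.mem_powersetCard.1 (Finset.mem_filter.1 hX).1).2]), Finset.sum_const, nsmul_eq_mul]
      by_cases h3 : 3 ≤ x
      · rw [if_pos h3, card_filter_subset_powersetCard hC hCc h3, hK, show N + 3 - 3 = N by omega]
      · rw [if_neg h3]
        have : ((K.powersetCard x).filter (fun X => C ⊆ X)) = ∅ := by
          rw [Finset.eq_empty_iff_forall_notMem]
          intro X hX
          rw [Finset.mem_filter, Finset.mem_powersetCard] at hX
          have := Finset.card_le_card hX.2
          omega
        rw [this, Finset.card_empty, Nat.cast_zero, zero_mul]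
    rw [Finset.sum_congr rfl hinner]
    rw [← Finset.sum_Ico_consecutive _ (show 1 ≤ 3 by norm_num) (show 3 ≤ n + 1 by omega)]
    have hz : ∑ x ∈ Finset.Ico 1 3, (if 3 ≤ x then (N.choose (x - 3) : ℚ) * g x else 0) = 0 := by
      apply Finset.sum_eq_zero
      intro x hx
      rw [Finset.mem_Ico] at hx
      rw [if_neg (by omega)]
    rw [hz, zero_add, Finset.sum_Ico_eq_sum_range, show n + 1 - 3 = n - 2 by omega]
    apply Finset.sum_congr rfl
    intro j _
    rw [if_pos (by omega), show 3 + j - 3 = j by omega, add_comm 3 j]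
  · exact (K.pairwise_disjoint_powersetCard.set_pairwise _).mono' (fun x y h => by
      exact Finset.disjoint_filter_filter h)

omit [M.Finite] in
/-- **The union bound.**  The witnesses avoiding every triple `C ℓ`, `ℓ ∈ Λ′`, pay at least the full sum minus
`#Λ′` times the sum over the witnesses through one fixed triple. -/
theorem sum_good_ge_sub {K : Finset α} {n N : ℕ} (hn : 2 ≤ n) (hK : K.card = N + 3)
    (Λ' : Finset (Finset α)) (C : Finset α → Finset α) (hC : ∀ ℓ ∈ Λ', C ℓ ⊆ K ∧ (C ℓ).card = 3)
    (g : ℕ → ℚ) (hg : ∀ x, 0 ≤ g x) :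
    ∑ X ∈ witnessFamily K n, g X.card - (Λ'.card : ℚ) * ∑ j ∈ range (n - 2), (N.choose j : ℚ) * g (j + 3) ≤
      ∑ X ∈ witnessFamily K n, (if ∀ ℓ ∈ Λ', ¬ C ℓ ⊆ X then g X.card else 0) := by
  classical
  -- the bad witnesses, bounded by the sum of the indicators
  have hbad : ∀ X ∈ witnessFamily K n, (if ∀ ℓ ∈ Λ', ¬ C ℓ ⊆ X then 0 else g X.card) ≤
      ∑ ℓ ∈ Λ', (if C ℓ ⊆ X then g X.card else 0) := by
    intro X _
    by_cases hgood : ∀ ℓ ∈ Λ', ¬ C ℓ ⊆ X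
    · rw [if_pos hgood]
      exact Finset.sum_nonneg (fun ℓ _ => by split_ifs <;> simp [hg])
    · rw [if_neg hgood]
      push Not at hgood
      obtain ⟨ℓ, hℓ, hℓX⟩ := hgood
      calc g X.card = (if C ℓ ⊆ X then g X.card else 0) := by rw [if_pos hℓX]
        _ ≤ ∑ ℓ ∈ Λ', (if C ℓ ⊆ X then g X.card else 0) :=
            Finset.single_le_sum (f := fun ℓ => if C ℓ ⊆ X then g X.card else 0)
              (fun ℓ _ => by split_ifs <;> simp [hg]) hℓ
  have hsplit : ∀ X, g X.card = (if ∀ ℓ ∈ Λ', ¬ C ℓ ⊆ X then g X.card else 0) +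
      (if ∀ ℓ ∈ Λ', ¬ C ℓ ⊆ X then 0 else g X.card) := by
    intro X
    split_ifs <;> ring
  have hlost : ∀ ℓ ∈ Λ', ∑ X ∈ witnessFamily K n, (if C ℓ ⊆ X then g X.card else 0) =
      ∑ j ∈ range (n - 2), (N.choose j : ℚ) * g (j + 3) := by
    intro ℓ hℓ
    rw [← Finset.sum_filter, sum_filter_subset_witnessFamily' hn hK (hC ℓ hℓ).1 (hC ℓ hℓ).2 g]
  have htotal : ∑ X ∈ witnessFamily K n, (if ∀ ℓ ∈ Λ', ¬ C ℓ ⊆ X then 0 else g X.card) ≤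
      (Λ'.card : ℚ) * ∑ j ∈ range (n - 2), (N.choose j : ℚ) * g (j + 3) := by
    calc ∑ X ∈ witnessFamily K n, (if ∀ ℓ ∈ Λ', ¬ C ℓ ⊆ X then 0 else g X.card)
        ≤ ∑ X ∈ witnessFamily K n, ∑ ℓ ∈ Λ', (if C ℓ ⊆ X then g X.card else 0) := Finset.sum_le_sum hbad
      _ = ∑ ℓ ∈ Λ', ∑ X ∈ witnessFamily K n, (if C ℓ ⊆ X then g X.card else 0) := Finset.sum_comm
      _ = ∑ ℓ ∈ Λ', ∑ j ∈ range (n - 2), (N.choose j : ℚ) * g (j + 3) := Finset.sum_congr rfl hlost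
      _ = (Λ'.card : ℚ) * ∑ j ∈ range (n - 2), (N.choose j : ℚ) * g (j + 3) := by
          rw [Finset.sum_const, nsmul_eq_mul]
  have hsum : ∑ X ∈ witnessFamily K n, g X.card =
      ∑ X ∈ witnessFamily K n, (if ∀ ℓ ∈ Λ', ¬ C ℓ ⊆ X then g X.card else 0) +
      ∑ X ∈ witnessFamily K n, (if ∀ ℓ ∈ Λ', ¬ C ℓ ⊆ X then 0 else g X.card) := by
    rw [← Finset.sum_add_distrib]
    exact Finset.sum_congr rfl (fun X _ => hsplit X)
  linarith

/-- The conservative share function of the profile accounting: the crude `𝒯₀` share for `≤ 5` points, `1` beyond. -/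
noncomputable def profileShare (M : Matroid α) (B X : Finset α) : ℚ :=
  if B.card ≤ 5 then (rho3 M B : ℚ) / (((B.card + X.card).choose 3 : ℕ) : ℚ) else 1

omit [DecidableEq α] [M.Finite] in
/-- The profile share is nonnegative. -/
theorem profileShare_nonneg (B X : Finset α) : 0 ≤ profileShare M B X := by
  unfold profileShare
  split_ifs <;> positivity

open scoped Classical in
/-- **The profile assembly.**  On the core, for an independent `K ⊆ E ∖ G`, a set `Λ` of dependent triples of `G` such
that every dependent triple outside `Λ` has no coplanar triple in `K`, and triples `C ℓ` whose non-supersets are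
good witnesses for `ℓ ∈ Λ`, every family `𝔅` of rank-`3` subsets of `G` satisfies
`Σ_{B′ ∈ 𝔅} Σ_X [X avoids C ℓ for every ℓ ∈ Λ inside B′] · share(B′, X) ≤ Σ_{S ∈ Yq} w⁺(G, S)`. -/
theorem supply_ge_profile {p : ℕ} (hc : Core M p) {G K : Finset α} (hG : G ∈ flatsQ M 3)
    (hKsub : K ⊆ gr M \ G) (hKind : M.Indep (K : Set α)) (n : ℕ)
    (Λ : Finset (Finset α)) (hΛ : ∀ ℓ ∈ depTriples M G, ℓ ∉ Λ → coplanarTriples M ℓ K = ∅)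
    (C : Finset α → Finset α) (hC : ∀ ℓ ∈ Λ, ∀ X, ¬ C ℓ ⊆ X → GoodWitness M ℓ K X)
    {𝔅 : Finset (Finset α)} (h𝔅 : ∀ B ∈ 𝔅, B ⊆ G ∧ M.eRk (B : Set α) = 3) :
    ∑ B ∈ 𝔅, ∑ X ∈ witnessFamily K n,
        (if ∀ ℓ ∈ Λ, ℓ ⊆ B → ¬ C ℓ ⊆ X then profileShare M B X else 0) ≤
      ∑ S ∈ Yq M (n + 4) 3, wPlus M G S := by
  have hKG : Disjoint K G := by
    rw [Finset.disjoint_left]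
    intro x hxK hxG
    have := hKsub hxK
    rw [Finset.mem_sdiff] at this
    exact this.2 hxG
  apply supply_ge_of_family hG h𝔅 hKsub hKind n
  intro B hB X hX
  obtain ⟨hXK, _, _⟩ := mem_witnessFamily hX
  have hXind : M.Indep (X : Set α) := hKind.subset (Finset.coe_subset.2 hXK)
  have hXG : Disjoint X G := Finset.disjoint_of_subset_left hXK hKG
  have hBG := (h𝔅 B hB).1
  by_cases hgd : ∀ ℓ ∈ Λ, ℓ ⊆ B → ¬ C ℓ ⊆ X
  · rw [if_pos hgd]
    have hgood : ∀ ℓ ∈ depTriples M G, ℓ ⊆ B → GoodWitness M ℓ K X := by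
      intro ℓ hℓ hℓB
      by_cases hℓΛ : ℓ ∈ Λ
      · exact hC ℓ hℓΛ X (hgd ℓ hℓΛ hℓB)
      · intro C' hC'
        rw [hΛ ℓ hℓ hℓΛ] at hC'
        exact absurd hC' (Finset.notMem_empty C')
    unfold profileShare
    by_cases h5 : B.card ≤ 5
    · rw [if_pos h5]
      exact wPlus_ge_of_good hc hG hBG h5 hXind hXG hXK hgood
    · rw [if_neg h5]
      rcases Nat.lt_or_ge B.card 7 with h6 | h7
      · exact le_of_eq (wPlus_eq_one_of_six_good hc hG hBG (by omega) hXind hXG hXK hgood).symm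
      · exact le_of_eq (wPlus_eq_one_of_seven_le hc hG hBG h7 hXind hXG).symm
  · rw [if_neg hgd]
    exact wPlus_nonneg M G (B ∪ X)

/-- A bottom set `B′ ⊆ G` has `ρ(G ∖ B′) ≥ t` when `ρ(E ∖ G) + t ≤ p`. -/
theorem eRk_sdiff_ge_of_mem_UqG {G B : Finset α} {p t e : ℕ} (hB : B ∈ UqG M p 3 G)
    (he : M.eRk ((gr M \ G : Finset α) : Set α) = e) (het : e + t ≤ p) :
    (t : ℕ∞) ≤ M.eRk ((G \ B : Finset α) : Set α) := by
  unfold UqG at hB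
  rw [Finset.mem_filter, mem_Uq] at hB
  obtain ⟨⟨_, _, hBp⟩, _⟩ := hB
  have h1 := eRk_sdiff_le_add M G B (gr M)
  rw [hBp, he] at h1
  obtain ⟨k, hk, _⟩ := eRk_eq_nat M (G \ B)
  rw [hk] at h1 ⊢
  have h2 : p ≤ k + e := by exact_mod_cast h1
  exact_mod_cast (by omega : t ≤ k)

/-- A line of the plane is not inside `cl(E ∖ G)` at `t ≥ 2` (`ρ(E ∖ G) + 2 ≤ ρ(E)`); hence no coplanar triple. -/
theorem coplanarTriples_eq_empty_of_two_le {p : ℕ} (hc : Core M p) {G ℓ K : Finset α} (hG : G ∈ flatsQ M 3)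
    (hℓ : ℓ ∈ depTriples M G) (hKsub : K ⊆ gr M \ G) (hKind : M.Indep (K : Set α))
    (hlt : M.eRk ((gr M \ G : Finset α) : Set α) + 1 < M.eRank) : coplanarTriples M ℓ K = ∅ := by
  classical
  have hGE : G ⊆ gr M := (mem_flatsQ.1 hG).1
  unfold depTriples at hℓ
  rw [Finset.mem_filter, Finset.mem_powersetCard] at hℓ
  obtain ⟨⟨hℓG, hℓc⟩, hℓdep⟩ := hℓ
  have hℓr : M.eRk (ℓ : Set α) = 2 := eRk_eq_two_of_dep_triple (simpleOn_of_core hc hGE) hℓG hℓc hℓdep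
  -- a point of `G` off `ℓ`
  have hG3 : M.eRk (G : Set α) = 3 := eRk_eq_three_of_mem_flatsQ' hG
  obtain ⟨g, hg⟩ : ∃ g, g ∈ G \ ℓ := by
    by_contra h
    push Not at h
    have hsub : G ⊆ ℓ := fun x hx => by
      by_contra hxℓ
      exact h x (Finset.mem_sdiff.2 ⟨hx, hxℓ⟩)
    have := M.eRk_mono (Finset.coe_subset.2 hsub)
    rw [hG3, hℓr] at this
    exact absurd this (by decide)
  rw [Finset.mem_sdiff] at hg
  have hr : M.eRk ((insert g ℓ : Finset α) : Set α) = 3 :=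
    eRk_eq_three_of_four_le_of_core hc hG (Finset.insert_subset hg.1 hℓG)
      (by rw [Finset.card_insert_of_notMem hg.2, hℓc])
  have hnot := not_line_subset_closure_compl_of_rank hG hℓG hg.1 hr hlt
  have hℓE : (ℓ : Set α) ⊆ M.E := by
    rw [← coe_gr M]; exact Finset.coe_subset.2 (hℓG.trans hGE)
  exact coplanarTriples_eq_empty_of_not_subset hℓE hKsub hKind hnot

end NightThree

end PercRepro
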